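import Literature.Combinatorics.Additive.ProductSpaceEncodings
import Literature.Combinatorics.Additive.ProductSpaceSharpLevelDInequality
import HarnessLib

/-!
# Hypercontractivity for general functions on `[m]^N` (KLM Lemma 3.2, Prop 3.1, Thm 4.1) and the discharge of `KellerLifshitzMarcus2023_thm54`

Source: N. Keller, N. Lifshitz, O. Marcus, *Sharp hypercontractivity for global functions*,
arXiv:2307.01356 = J. Eur. Math. Soc. 2026 [KellerLifshitzMarcus2023], §3.2 (Lemma 3.2, Claim 3.3,
Lemma 3.4, Prop 3.1 with its tensorisation proof) and §4.1 (Thm 4.1), pp. 23–25, 31–33 of the arXiv version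
(read first-hand; cell pnp-psdrank, lit g23). Last file of the programme discharging the tree's named fact
`ProductSpace.KellerLifshitzMarcus2023_thm54` (`ProductSpaceLevelInequality.lean`): it proves the
hypercontractive estimate `HcEstimate q ρ f` of KLM Thm 4.1 for every `f : [m]^N → ℝ` (`m ≥ 1`, `q > 2`,
`0 < ρ ≤ 1/3`), and then `KellerLifshitzMarcus2023_thm54_holds` by `klm_thm54_of_hcEstimate`
(`ProductSpaceSharpLevelDInequality.lean`).

THE ARGUMENT (as printed, with Rademacher encodings — see `ProductSpaceEncodings.lean`):
* Claim 3.3 / Lemma 3.2 (`abs_rpow_le_tangent_quad`, `abs_one_add_mul_rpow_le`): the pointwise inequality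
  `|1 + ρu|^q ≤ 1 + qρu + (q²/9) u² + β^q |u|^q`, `β = ρ(1 + 2(q-2)/log(1/ρ))`, from the degree-`1` Taylor
  bound of `|1+y|^q` on `ρ|u| < ω` (`(1+ω)^{q-2} ≤ e^{ω(q-2)} = ρ^{-1/2}`, `ρ^{3/2}/2 ≤ 1/9`) and
  `|1 + ρu| ≤ β|u|` on `ρ|u| ≥ ω`; the Taylor bound is proved by monotonicity (first derivative only).
* Lemma 3.4 in a fibre (`fiber_ineq`): `E_a |E + ρψ_a|^q ≤ E_z |E + m^{-1/2}∑_a ψ_a χ_{(i,a)}(z)|^q + β^q E_a|ψ_a|^q`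
  for `∑_a ψ_a = 0`, using the odd-moment lower bound `E|1+W|^q ≥ 1 + (q²/9) E W²`
  (`HypercontractivityTwoQ.one_add_mul_avg_sq_le_avg_abs_rpow`).
* (3.3) (`lqM_noiseOn_single_le`): `‖T^{(i)}_ρ F‖_q^q ≤ ‖G_i F‖_q^q + β^q ‖L_i F‖_q^q`, by averaging the fibre
  inequality ("apply Lemma 3.4 to the restricted function and take expectations").
* Prop 3.1 (`lqM_noiseOn_le_sum_encA`): `‖T_{ρ,A} F‖_q^q ≤ ∑_{S⊆A} β^{q|S|} ‖L_S G_{A∖S} F‖_q^q` by induction on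
  `A` (KLM induct on `m ≤ n`; all operators commute, so no ordering is needed), using Lemma 4.3(2).
* Thm 4.1 (`hcEstimate`): `T_{ρ/√q} = T_ρ T_{1/√q}`, Prop 3.1, Fubini over the frozen coordinates,
  `D_{S,x} T_σ = σ^{|S|} T_σ D_{S,x}` (Lemma 2.2), `G_{S^c} T^{Ω}_σ = T^{cube}_σ G_{S^c}` (Lemma 4.3(1)),
  `(2,q)`-hypercontractivity on the cube with `σ = 1/√q ≤ 1/√(q-1)` (Bonami–Gross in place of the Gaussian
  Thm 4.2), and "`G_{S^c}` preserves `2`-norms".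

All proved, `0` sorry, no new facts. WHAT THIS IS NOT: no Gaussian space; nothing about `S_n`; no P-vs-NP content.
-/

noncomputable section

namespace Literature.Combinatorics.Additive.ProductSpace

open Finset
open Literature.Probability.RandomGraphs.LowDegree (sgn sgn_mul_self)
open Literature.Computability.Complexity.LowDegree (flipAll one_add_mul_avg_sq_le_avg_abs_rpow)

/-! ## Claim 3.3: the degree-one Taylor bound for `|t|^q` -/

section Calculus

/-- Tangent-line inequality for `u ↦ u^p` (`p ≥ 1`) at the point `t > 0`, evaluated at `1`:
`t^p ≤ 1 + p t^{p-1} (t - 1)`. [cite: KellerLifshitzMarcus2023, Claim 3.3 (proof: Taylor approximation of `|1+y|^q`)] -/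
theorem rpow_le_one_add_tangent {p t : ℝ} (hp : 1 ≤ p) (ht : 0 < t) :
    t ^ p ≤ 1 + p * t ^ (p - 1) * (t - 1) := by
  have hs : -1 ≤ t⁻¹ - 1 := by linarith [inv_pos.2 ht]
  have hB := one_add_mul_self_le_rpow_one_add hs hp
  rw [show (1 : ℝ) + (t⁻¹ - 1) = t⁻¹ by ring, Real.inv_rpow ht.le] at hB
  have htp : 0 < t ^ p := Real.rpow_pos_of_pos ht p
  have h1 : t ^ p * (1 + p * (t⁻¹ - 1)) ≤ 1 := by
    have := mul_le_mul_of_nonneg_left hB htp.le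
    rwa [mul_inv_cancel₀ htp.ne'] at this
  have h2 : t ^ p * t⁻¹ = t ^ (p - 1) := by rw [Real.rpow_sub_one ht.ne', div_eq_mul_inv]
  have h3 : t ^ (p - 1) * t = t ^ p := by rw [Real.rpow_sub_one ht.ne', div_mul_cancel₀ _ ht.ne']
  linear_combination h1 - p * h2 - p * h3

/-- Derivative of the gap function `ψ(t) = 1 + q(t-1) + ½q(q-1)M(t-1)² - |t|^q`. [cite: KellerLifshitzMarcus2023, Claim 3.3 (proof)] -/
private theorem hasDerivAt_gap {q : ℝ} (M : ℝ) (hq : 1 < q) (t : ℝ) :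
    HasDerivAt (fun t : ℝ => 1 + q * (t - 1) + q * (q - 1) / 2 * M * (t - 1) ^ 2 - |t| ^ q)
      (q + q * (q - 1) * M * (t - 1) - q * |t| ^ (q - 2) * t) t := by
  have ha := (hasDerivAt_id' t).sub_const 1
  have hb := (ha.const_mul q).const_add 1
  have hc := (ha.pow 2).const_mul (q * (q - 1) / 2 * M)
  have hd := (hb.add hc).sub (hasDerivAt_abs_rpow t hq)
  refine hd.congr_deriv ?_
  simp only [Nat.cast_ofNat, pow_one, Nat.add_one_sub_one]
  ring

/-- **KLM Claim 3.3 (Taylor form)**: for `q ≥ 2`, `L ≥ 1` and `|t| ≤ L`,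
`|t|^q ≤ 1 + q(t-1) + ½ q(q-1) L^{q-2} (t-1)²` (degree-one Taylor expansion of `|1+y|^q` at `y = 0` with the
remainder bounded through `|1+y'|^{q-2} ≤ (1+|y|)^{q-2} ≤ L^{q-2}`). [cite: KellerLifshitzMarcus2023, Claim 3.3] -/
theorem abs_rpow_le_tangent_quad {q L t : ℝ} (hq : 2 ≤ q) (hL : 1 ≤ L) (ht1 : -L ≤ t) (ht2 : t ≤ L) :
    |t| ^ q ≤ 1 + q * (t - 1) + q * (q - 1) / 2 * L ^ (q - 2) * (t - 1) ^ 2 := by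
  set M := L ^ (q - 2) with hM
  have hM1 : 1 ≤ M := Real.one_le_rpow hL (by linarith)
  have hq1 : 1 < q := by linarith
  have hq0 : 0 < q := by linarith
  set f : ℝ → ℝ := fun t => 1 + q * (t - 1) + q * (q - 1) / 2 * M * (t - 1) ^ 2 - |t| ^ q with hf
  have hder : ∀ s, HasDerivAt f (q + q * (q - 1) * M * (s - 1) - q * |s| ^ (q - 2) * s) s :=
    fun s => hasDerivAt_gap M hq1 s
  have hcont : Continuous f := by
    have : Differentiable ℝ f := fun s => (hder s).differentiableAt
    exact this.continuous
  have hf1 : f 1 = 0 := by simp [hf]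
  -- `|s|^{q-2} ≤ M` for `|s| ≤ L`
  have hpowM : ∀ s : ℝ, |s| ≤ L → |s| ^ (q - 2) ≤ M := fun s hs =>
    Real.rpow_le_rpow (abs_nonneg s) hs (by linarith)
  suffices h0 : 0 ≤ f t by
    have : f t = 1 + q * (t - 1) + q * (q - 1) / 2 * M * (t - 1) ^ 2 - |t| ^ q := rfl
    linarith
  by_cases h : 1 ≤ t
  · -- increasing on `[1, L]`
    have hmono : MonotoneOn f (Set.Icc 1 L) := by
      refine monotoneOn_of_deriv_nonneg (convex_Icc 1 L) hcont.continuousOn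
        (fun s _ => (hder s).differentiableAt.differentiableWithinAt) (fun s hs => ?_)
      rw [interior_Icc, Set.mem_Ioo] at hs
      rw [(hder s).deriv]
      have hs0 : 0 < s := by linarith
      have habs : |s| = s := abs_of_pos hs0
      have hpow : |s| ^ (q - 2) * s = s ^ (q - 1) := by
        rw [habs, show q - 1 = (q - 2) + 1 by ring, Real.rpow_add hs0, Real.rpow_one]
      have htan := rpow_le_one_add_tangent (p := q - 1) (by linarith) hs0
      rw [show q - 1 - 1 = q - 2 by ring] at htan
      have hsM : s ^ (q - 2) ≤ M := by
        have := hpowM s (by rw [habs]; exact hs.2.le); rwa [habs] at this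
      have hkey : s ^ (q - 1) ≤ 1 + (q - 1) * M * (s - 1) := by
        have : (q - 1) * s ^ (q - 2) * (s - 1) ≤ (q - 1) * M * (s - 1) :=
          mul_le_mul_of_nonneg_right (mul_le_mul_of_nonneg_left hsM (by linarith)) (by linarith)
        linarith
      have : q * |s| ^ (q - 2) * s = q * s ^ (q - 1) := by rw [mul_assoc, hpow]
      rw [this]
      nlinarith [mul_le_mul_of_nonneg_left hkey hq0.le]
    have := hmono ⟨le_refl 1, hL⟩ ⟨h, ht2⟩ h
    rw [hf1] at this
    exact this
  · -- decreasing on `[-L, 1]`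
    have ht : t < 1 := not_le.1 h
    have hanti : AntitoneOn f (Set.Icc (-L) 1) := by
      refine antitoneOn_of_deriv_nonpos (convex_Icc (-L) 1) hcont.continuousOn
        (fun s _ => (hder s).differentiableAt.differentiableWithinAt) (fun s hs => ?_)
      rw [interior_Icc, Set.mem_Ioo] at hs
      rw [(hder s).deriv]
      -- want `1 + (q-1) M (s-1) ≤ |s|^{q-2} s`
      suffices hkey : 1 + (q - 1) * M * (s - 1) ≤ |s| ^ (q - 2) * s by
        have : q * |s| ^ (q - 2) * s = q * (|s| ^ (q - 2) * s) := by ring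
        rw [this]
        nlinarith [mul_le_mul_of_nonneg_left hkey hq0.le]
      rcases le_or_gt 0 s with hs0 | hs0
      · -- `0 ≤ s < 1`: `|s|^{q-2} s = s^{q-1} ≥ 1 + (q-1)(s-1) ≥ 1 + (q-1)M(s-1)`
        have hpow : |s| ^ (q - 2) * s = s ^ (q - 1) := by
          rw [abs_of_nonneg hs0]
          rcases eq_or_lt_of_le hs0 with h0 | h0
          · rw [← h0, mul_zero, Real.zero_rpow (by linarith)]
          · rw [show q - 1 = (q - 2) + 1 by ring, Real.rpow_add h0, Real.rpow_one]
        have hB := one_add_mul_self_le_rpow_one_add (show (-1 : ℝ) ≤ s - 1 by linarith)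
          (show (1 : ℝ) ≤ q - 1 by linarith)
        rw [show (1 : ℝ) + (s - 1) = s by ring] at hB
        rw [hpow]
        have hprod : 0 ≤ (q - 1) * (1 - s) * (M - 1) :=
          mul_nonneg (mul_nonneg (by linarith) (by linarith [hs.2])) (by linarith)
        have : (q - 1) * M * (s - 1) ≤ (q - 1) * (s - 1) := by nlinarith [hprod]
        linarith
      · -- `s < 0`: `|s|^{q-2} s ≥ M s ≥ 1 + (q-1)M(s-1)`
        have hsM : |s| ^ (q - 2) ≤ M := hpowM s (by rw [abs_of_neg hs0]; linarith)
        have h1 : M * s ≤ |s| ^ (q - 2) * s := mul_le_mul_of_nonpos_right hsM hs0.le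
        have h3 : 0 ≤ (q - 2) * M := mul_nonneg (by linarith) (by linarith)
        have h4 : (q - 2) * M * s ≤ 0 := by nlinarith [h3, hs0]
        have h2 : 1 + (q - 1) * M * (s - 1) ≤ M * s := by nlinarith [h3, h4, hM1]
        linarith
    have := hanti ⟨ht1, ht.le⟩ ⟨by linarith, le_refl 1⟩ ht.le
    rw [hf1] at this
    exact this

/-- `ρ^{3/2} ≤ 2/9` for `ρ ≤ 1/3`, in the form `(1/ρ)^{1/2} ρ² ≤ 2/9`. [cite: KellerLifshitzMarcus2023, Lemma 3.2 (proof: "`1 + ρ^{1.5} q²d²/2 ≤ 1 + q²d²/9`")] -/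
theorem inv_rpow_half_mul_sq_le {ρ : ℝ} (hρ0 : 0 < ρ) (hρ : ρ ≤ 1 / 3) :
    (1 / ρ) ^ (1 / 2 : ℝ) * ρ ^ 2 ≤ 2 / 9 := by
  have hs : (1 / ρ) ^ (1 / 2 : ℝ) = (Real.sqrt ρ)⁻¹ := by
    rw [← Real.sqrt_eq_rpow, one_div, Real.sqrt_inv]
  have hsr : Real.sqrt ρ ≤ 3 / 5 := by
    rw [show (3 / 5 : ℝ) = Real.sqrt ((3 / 5) ^ 2) by rw [Real.sqrt_sq (by norm_num)]]
    exact Real.sqrt_le_sqrt (by nlinarith)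
  have hsp : 0 < Real.sqrt ρ := Real.sqrt_pos.2 hρ0
  rw [hs, show (Real.sqrt ρ)⁻¹ * ρ ^ 2 = ρ * (ρ / Real.sqrt ρ) by rw [sq]; field_simp, Real.div_sqrt]
  nlinarith

/-- **KLM Lemma 3.2, pointwise form**: for `q > 2` and `0 < ρ ≤ 1/3`, every real `u` satisfies
`|1 + ρu|^q ≤ 1 + qρu + (q²/9) u² + β^q |u|^q`, `β = ρ(1 + 2(q-2)/log(1/ρ))` (the two regimes
`ρ|u| < ω` — Claim 3.3 with `(1+ω)^{q-2} ≤ e^{ω(q-2)} = ρ^{-1/2}` — and `ρ|u| ≥ ω`, where `|1+ρu| ≤ β|u|`,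
`ω = log(1/ρ)/(2(q-2))`). [cite: KellerLifshitzMarcus2023, Lemma 3.2 and Claim 3.3] -/
theorem abs_one_add_mul_rpow_le {q ρ : ℝ} (hq : 2 < q) (hρ0 : 0 < ρ) (hρ : ρ ≤ 1 / 3) (u : ℝ) :
    |1 + ρ * u| ^ q ≤ 1 + q * ρ * u + q ^ 2 / 9 * u ^ 2 + klmBeta q ρ ^ q * |u| ^ q := by
  have hq0 : 0 < q := by linarith
  have hlog : 0 < Real.log (1 / ρ) := Real.log_pos (by rw [lt_div_iff₀ hρ0]; linarith)
  set ω : ℝ := Real.log (1 / ρ) / (2 * (q - 2)) with hω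
  have hω0 : 0 < ω := by positivity
  have hβ : klmBeta q ρ = ρ * (1 + 1 / ω) := by
    unfold klmBeta; rw [hω]; congr 1; field_simp
  have hβ0 : 0 ≤ klmBeta q ρ := by rw [hβ]; positivity
  -- the quadratic part is nonnegative (`ρ ≤ 2/3`)
  have hquad : 0 ≤ 1 + q * ρ * u + q ^ 2 / 9 * u ^ 2 := by
    nlinarith [sq_nonneg (q * u / 3 + 3 * ρ / 2), sq_nonneg ρ]
  by_cases hcase : ω ≤ ρ * |u|
  · -- large `|u|`: `|1 + ρu| ≤ β |u|`
    have h1 : |1 + ρ * u| ≤ klmBeta q ρ * |u| := by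
      calc |1 + ρ * u| ≤ 1 + ρ * |u| := by
            have := abs_add_le (1 : ℝ) (ρ * u); rwa [abs_one, abs_mul, abs_of_pos hρ0] at this
        _ ≤ ρ * |u| / ω + ρ * |u| := by
            have : 1 ≤ ρ * |u| / ω := by rw [le_div_iff₀ hω0]; linarith
            linarith
        _ = klmBeta q ρ * |u| := by rw [hβ]; field_simp; ring
    have h2 : |1 + ρ * u| ^ q ≤ (klmBeta q ρ * |u|) ^ q :=
      Real.rpow_le_rpow (abs_nonneg _) h1 hq0.le
    rw [Real.mul_rpow hβ0 (abs_nonneg u)] at h2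
    linarith
  · -- small `|u|`: Claim 3.3 at `t = 1 + ρu`, `L = 1 + ω`
    have hsmall : ρ * |u| < ω := not_le.1 hcase
    have hL : (1 : ℝ) ≤ 1 + ω := by linarith
    have hru : |ρ * u| = ρ * |u| := by rw [abs_mul, abs_of_pos hρ0]
    have ht1 : -(1 + ω) ≤ 1 + ρ * u := by
      have := neg_abs_le (ρ * u); rw [hru] at this; linarith
    have ht2 : 1 + ρ * u ≤ 1 + ω := by
      have := le_abs_self (ρ * u); rw [hru] at this; linarith
    have hC := abs_rpow_le_tangent_quad hq.le hL ht1 ht2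
    rw [show 1 + ρ * u - 1 = ρ * u by ring] at hC
    -- `(1+ω)^{q-2} ≤ ρ^{-1/2}`
    have hq2 : q - 2 ≠ 0 := ne_of_gt (by linarith)
    have hωq : ω * (q - 2) = Real.log (1 / ρ) / 2 := by
      rw [hω, div_mul_eq_mul_div, div_eq_div_iff (mul_ne_zero two_ne_zero hq2) two_ne_zero]
      ring
    have hLpow : (1 + ω) ^ (q - 2) ≤ (1 / ρ) ^ (1 / 2 : ℝ) := by
      calc (1 + ω) ^ (q - 2) ≤ Real.exp ω ^ (q - 2) :=
            Real.rpow_le_rpow (by linarith) (by linarith [Real.add_one_le_exp ω]) (by linarith)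
        _ = Real.exp (Real.log (1 / ρ) * (1 / 2)) := by
            rw [← Real.exp_mul]; congr 1; rw [hωq]; ring
        _ = (1 / ρ) ^ (1 / 2 : ℝ) := by rw [Real.rpow_def_of_pos (by positivity)]
    -- the coefficient of `u²`
    have hcoef : q * (q - 1) / 2 * (1 + ω) ^ (q - 2) * (ρ * u) ^ 2 ≤ q ^ 2 / 9 * u ^ 2 := by
      have h1 : q * (q - 1) / 2 * (1 + ω) ^ (q - 2) * (ρ * u) ^ 2 ≤
          q * (q - 1) / 2 * (1 / ρ) ^ (1 / 2 : ℝ) * (ρ * u) ^ 2 := by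
        have : 0 ≤ q * (q - 1) / 2 := by nlinarith
        exact mul_le_mul_of_nonneg_right (mul_le_mul_of_nonneg_left hLpow this) (sq_nonneg _)
      have h2 := inv_rpow_half_mul_sq_le hρ0 hρ
      have h3 : q * (q - 1) / 2 * (1 / ρ) ^ (1 / 2 : ℝ) * (ρ * u) ^ 2 =
          q * (q - 1) / 2 * ((1 / ρ) ^ (1 / 2 : ℝ) * ρ ^ 2) * u ^ 2 := by ring
      rw [h3] at h1
      have h4 : q * (q - 1) / 2 * ((1 / ρ) ^ (1 / 2 : ℝ) * ρ ^ 2) * u ^ 2 ≤ q * (q - 1) / 2 * (2 / 9) * u ^ 2 :=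
        mul_le_mul_of_nonneg_right (mul_le_mul_of_nonneg_left h2 (by nlinarith)) (sq_nonneg u)
      nlinarith [sq_nonneg u]
    have hlast : 0 ≤ klmBeta q ρ ^ q * |u| ^ q := by positivity
    linarith

end Calculus

/-! ## Lemma 3.2 / 3.4 in a fibre -/

section Fiber

variable {N m : ℕ}

/-- `ρ ≤ β`. [cite: KellerLifshitzMarcus2023, Lemma 3.2 ("the inequality `‖ρf‖_q^q ≤ β^q ‖f‖_q^q` which holds trivially")] -/
theorem le_klmBeta {q ρ : ℝ} (hq : 2 ≤ q) (hρ0 : 0 < ρ) (hρ1 : ρ < 1) : ρ ≤ klmBeta q ρ := by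
  unfold klmBeta
  have hlog : 0 < Real.log (1 / ρ) := Real.log_pos (by rw [lt_div_iff₀ hρ0]; linarith)
  have : (1 : ℝ) ≤ 1 + 2 * (q - 2) / Real.log (1 / ρ) := by
    have : 0 ≤ 2 * (q - 2) / Real.log (1 / ρ) := by positivity
    linarith
  exact le_mul_of_one_le_right hρ0.le this

/-- **KLM Lemma 3.4 in a fibre (Rademacher form).** For `q > 2`, `0 < ρ ≤ 1/3`, a constant `E` and a
mean-zero `ψ : [m] → ℝ`:
`m⁻¹∑_a |E + ρψ_a|^q ≤ E_z |E + m^{-1/2}∑_a ψ_a χ_{(i,a)}(z)|^q + β^q m⁻¹∑_a |ψ_a|^q`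
(Lemma 3.2 with `X = ψ/σ` uniform on `[m]` and the symmetric variable `m^{-1/2}∑_a (ψ_a/σ) χ_{(i,a)}`
in place of the Gaussian). [cite: KellerLifshitzMarcus2023, Lemma 3.4 (via Lemma 3.2)] -/
theorem fiber_ineq [NeZero m] {q ρ : ℝ} (hq : 2 < q) (hρ0 : 0 < ρ) (hρ : ρ ≤ 1 / 3) (E : ℝ)
    (ψ : Fin m → ℝ) (hψ : ∑ a, ψ a = 0) (i : Fin N) :
    (∑ a, |E + ρ * ψ a| ^ q) / m ≤
      mean (α := fun _ : Fin N × Fin m => Bool)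
          (fun z => |E + ∑ a, ((Real.sqrt m)⁻¹ * ψ a) * sgn (z (i, a))| ^ q) +
        klmBeta q ρ ^ q * ((∑ a, |ψ a| ^ q) / m) := by
  have hm : (0 : ℝ) < m := by exact_mod_cast Nat.pos_of_ne_zero (NeZero.ne m)
  have hq0 : 0 < q := by linarith
  have hβ0 : 0 ≤ klmBeta q ρ := klmBeta_nonneg hq.le hρ0.le (by linarith)
  have hcube : 0 ≤ mean (α := fun _ : Fin N × Fin m => Bool)
      (fun z => |E + ∑ a, ((Real.sqrt m)⁻¹ * ψ a) * sgn (z (i, a))| ^ q) :=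
    mean_nonneg fun z => by positivity
  by_cases hE : E = 0
  · subst hE
    have h1 : (∑ a, |0 + ρ * ψ a| ^ q) / m = ρ ^ q * ((∑ a, |ψ a| ^ q) / m) := by
      rw [mul_div_assoc', Finset.mul_sum]
      congr 1
      refine Finset.sum_congr rfl fun a _ => ?_
      rw [zero_add, abs_mul, abs_of_pos hρ0, Real.mul_rpow hρ0.le (abs_nonneg _)]
    have hρβ : ρ ^ q ≤ klmBeta q ρ ^ q :=
      Real.rpow_le_rpow hρ0.le (le_klmBeta hq.le hρ0 (by linarith)) hq0.le
    have hS : 0 ≤ (∑ a, |ψ a| ^ q) / m := by positivity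
    rw [h1]
    nlinarith [mul_le_mul_of_nonneg_right hρβ hS]
  · -- normalise by `E`
    haveI : Nonempty (Fin N × Fin m) := ⟨(i, 0)⟩
    set u : Fin m → ℝ := fun a => ψ a / E with hu_def
    have hu : ∀ a, ψ a = E * u a := fun a => by rw [hu_def]; field_simp
    have hsumu : ∑ a, u a = 0 := by
      have : ∑ a, u a = (∑ a, ψ a) / E := by rw [hu_def, Finset.sum_div]
      rw [this, hψ, zero_div]
    have hA : 0 ≤ |E| ^ q := by positivity
    -- pointwise Lemma 3.2 and summation over the fibre
    have hPW : (∑ a, |E + ρ * ψ a| ^ q) / m ≤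
        |E| ^ q * (1 + q ^ 2 / 9 * ((∑ a, u a ^ 2) / m) + klmBeta q ρ ^ q * ((∑ a, |u a| ^ q) / m)) := by
      have h1 : ∑ a, |E + ρ * ψ a| ^ q ≤
          ∑ a, |E| ^ q * (1 + q * ρ * u a + q ^ 2 / 9 * u a ^ 2 + klmBeta q ρ ^ q * |u a| ^ q) := by
        refine Finset.sum_le_sum fun a _ => ?_
        rw [hu a, show E + ρ * (E * u a) = E * (1 + ρ * u a) by ring, abs_mul,
          Real.mul_rpow (abs_nonneg _) (abs_nonneg _)]
        exact mul_le_mul_of_nonneg_left (abs_one_add_mul_rpow_le hq hρ0 hρ (u a)) hA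
      have h2 : ∑ a, |E| ^ q * (1 + q * ρ * u a + q ^ 2 / 9 * u a ^ 2 + klmBeta q ρ ^ q * |u a| ^ q) =
          |E| ^ q * (m + q ^ 2 / 9 * ∑ a, u a ^ 2 + klmBeta q ρ ^ q * ∑ a, |u a| ^ q) := by
        rw [← Finset.mul_sum]
        congr 1
        simp only [Finset.sum_add_distrib, Finset.sum_const, Finset.card_univ, Fintype.card_fin,
          nsmul_eq_mul, mul_one, ← Finset.mul_sum, hsumu, mul_zero, add_zero]
      rw [h2] at h1
      have hre : |E| ^ q * (1 + q ^ 2 / 9 * ((∑ a, u a ^ 2) / m) + klmBeta q ρ ^ q * ((∑ a, |u a| ^ q) / m)) =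
          |E| ^ q * (m + q ^ 2 / 9 * ∑ a, u a ^ 2 + klmBeta q ρ ^ q * ∑ a, |u a| ^ q) / m := by
        field_simp
      rw [hre]
      exact div_le_div_of_nonneg_right h1 hm.le
    -- the sign side: `E + ∑ c_a χ_a = E (1 + W)`
    set W : Cube N m → ℝ := fun z => ∑ a, ((Real.sqrt m)⁻¹ * u a) * sgn (z (i, a)) with hW
    have hcz : (fun z : Cube N m => |E + ∑ a, ((Real.sqrt m)⁻¹ * ψ a) * sgn (z (i, a))| ^ q) =
        fun z => |E| ^ q * |1 + W z| ^ q := by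
      funext z
      have : E + ∑ a, ((Real.sqrt m)⁻¹ * ψ a) * sgn (z (i, a)) = E * (1 + W z) := by
        rw [hW, mul_add, mul_one, Finset.mul_sum]
        congr 1
        exact Finset.sum_congr rfl fun a _ => by rw [hu a]; ring
      rw [this, abs_mul, Real.mul_rpow (abs_nonneg _) (abs_nonneg _)]
    have hodd : ∀ e, W (flipAll e) = -W e := by
      intro e
      rw [hW]
      simp only
      rw [← Finset.sum_neg_distrib]
      refine Finset.sum_congr rfl fun a _ => ?_
      show (Real.sqrt m)⁻¹ * u a * sgn (!(e (i, a))) = -((Real.sqrt m)⁻¹ * u a * sgn (e (i, a)))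
      cases e (i, a) <;> simp [sgn]
    have hF1 := one_add_mul_avg_sq_le_avg_abs_rpow W hodd hq.le
    -- `E[W²] = m⁻¹ ∑ u_a²`
    have hW2 : (∑ e, W e ^ 2) / 2 ^ Fintype.card (Fin N × Fin m) = (∑ a, u a ^ 2) / m := by
      have h : mean (α := fun _ : Fin N × Fin m => Bool) (fun z => ((0 : ℝ) + W z) ^ 2) =
          mean (α := fun _ : Fin N × Fin m => Bool) (fun _ => (0 : ℝ) ^ 2) +
            ∑ a : Fin m, mean (α := fun _ : Fin N × Fin m => Bool) (fun _ => ((Real.sqrt m)⁻¹ * u a) ^ 2) :=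
        mean_sq_affine_sgn (κ := Fin N × Fin m) (c₀ := fun _ => (0 : ℝ))
          (c := fun a _ => (Real.sqrt m)⁻¹ * u a) (e := fun a : Fin m => (i, a))
          (fun a b h => by simpa using h) (fun _ _ _ _ => rfl) (fun _ _ _ _ _ => rfl)
      simp only [zero_add, mean_const, zero_pow two_ne_zero] at h
      unfold mean at h
      rw [cardX_cube] at h
      rw [h, eq_div_iff hm.ne', Finset.sum_mul]
      refine Finset.sum_congr rfl fun a _ => ?_
      rw [mul_pow, inv_pow, Real.sq_sqrt hm.le, inv_mul_eq_div, div_mul_cancel₀ _ hm.ne']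
    rw [hW2] at hF1
    -- the cube term is `|E|^q E|1+W|^q`
    have hC : mean (α := fun _ : Fin N × Fin m => Bool)
        (fun z => |E + ∑ a, ((Real.sqrt m)⁻¹ * ψ a) * sgn (z (i, a))| ^ q) =
        |E| ^ q * ((∑ e, |1 + W e| ^ q) / 2 ^ Fintype.card (Fin N × Fin m)) := by
      rw [hcz, mean_smul]
      unfold mean
      rw [cardX_cube]
    -- `β^q m⁻¹∑|ψ|^q = |E|^q β^q m⁻¹∑|u|^q`
    have hB : klmBeta q ρ ^ q * ((∑ a, |ψ a| ^ q) / m) =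
        |E| ^ q * (klmBeta q ρ ^ q * ((∑ a, |u a| ^ q) / m)) := by
      have : ∑ a, |ψ a| ^ q = |E| ^ q * ∑ a, |u a| ^ q := by
        rw [Finset.mul_sum]
        exact Finset.sum_congr rfl fun a _ => by
          rw [hu a, abs_mul, Real.mul_rpow (abs_nonneg _) (abs_nonneg _)]
      rw [this]; ring
    rw [hC, hB]
    have hmid : |E| ^ q * (1 + q ^ 2 / 9 * ((∑ a, u a ^ 2) / m)) ≤
        |E| ^ q * ((∑ e, |1 + W e| ^ q) / 2 ^ Fintype.card (Fin N × Fin m)) :=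
      mul_le_mul_of_nonneg_left hF1 hA
    calc (∑ a, |E + ρ * ψ a| ^ q) / m
        ≤ |E| ^ q * (1 + q ^ 2 / 9 * ((∑ a, u a ^ 2) / m) + klmBeta q ρ ^ q * ((∑ a, |u a| ^ q) / m)) := hPW
      _ = |E| ^ q * (1 + q ^ 2 / 9 * ((∑ a, u a ^ 2) / m)) +
            |E| ^ q * (klmBeta q ρ ^ q * ((∑ a, |u a| ^ q) / m)) := by ring
      _ ≤ |E| ^ q * ((∑ e, |1 + W e| ^ q) / 2 ^ Fintype.card (Fin N × Fin m)) +
            |E| ^ q * (klmBeta q ρ ^ q * ((∑ a, |u a| ^ q) / m)) := by linarith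

/-! ## (3.3): one coordinate -/

/-- `∑_a (L_i g)(x[i↦a]) = 0`. [cite: KellerLifshitzMarcus2023, §2.2 ("`V^{={1}}` consists of functions with expectation `0`")] -/
theorem sum_lap_singleton_update [NeZero m] (i : Fin N) (g : (Fin N → Fin m) → ℝ) (x : Fin N → Fin m) :
    ∑ a : Fin m, lap {i} g (Function.update x i a) = 0 := by
  have hm : (m : ℝ) ≠ 0 := by exact_mod_cast NeZero.ne m
  have hE : ∀ a, condAvg {i} g (Function.update x i a) = condAvg {i} g x := fun a =>
    dependsOff_condAvg {i} g _ _ (fun j hj => by rw [Function.update_of_ne (by simpa using hj)])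
  simp only [lap_singleton, hE, Finset.sum_sub_distrib, Finset.sum_const, Finset.card_univ,
    Fintype.card_fin, nsmul_eq_mul]
  rw [condAvg_singleton_eq, Fintype.card_fin, mul_div_cancel₀ _ hm, sub_self]

/-- **KLM (3.3)**: `‖T^{(i)}_ρ F‖_q^q ≤ ‖G_i F‖_q^q + β^q ‖L_i F‖_q^q` for `F` not reading the signs of block
`i` ("apply Lemma 3.4 to the restricted function `g_y` and take expectations").
[cite: KellerLifshitzMarcus2023, Prop. 3.1 (proof, eq. (3.3))] -/
theorem lqM_noiseOn_single_le [NeZero m] {q ρ : ℝ} (hq : 2 < q) (hρ0 : 0 < ρ) (hρ : ρ ≤ 1 / 3)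
    (i : Fin N) {F : MixFun N m} (hF : ∀ x, DependsOff (α := fun _ : Fin N × Fin m => Bool) (blk i) (F x)) :
    lqM q (opX (noiseOn ρ {i}) F) ≤ lqM q (enc1 i F) + klmBeta q ρ ^ q * lqM q (opX (lap {i}) F) := by
  have hm : (0 : ℝ) < m := by exact_mod_cast Nat.pos_of_ne_zero (NeZero.ne m)
  -- the fibre data at `(x, z)`
  set E : MixFun N m := opX (condAvg {i}) F with hEdef
  set ψ : (Fin N → Fin m) → Cube N m → Fin m → ℝ := fun x z a =>
    opX (lap {i}) F (Function.update x i a) z with hψdef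
  have hEa : ∀ x z a, E (Function.update x i a) z = E x z := fun x z a =>
    dependsOff_condAvg {i} (fun x' => F x' z) _ _ (fun j hj => by rw [Function.update_of_ne (by simpa using hj)])
  have hψ0 : ∀ x z, ∑ a, ψ x z a = 0 := fun x z => sum_lap_singleton_update i (fun x' => F x' z) x
  -- (T) the fibre of `‖T^{(i)} F‖_q^q`
  have hT : lqM q (opX (noiseOn ρ {i}) F) = meanM (fun x z => (∑ a, |E x z + ρ * ψ x z a| ^ q) / m) := by
    unfold lqM
    rw [← meanM_opX_condAvg {i}]
    congr 1
    funext x z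
    show condAvg {i} (fun x' => |opX (noiseOn ρ {i}) F x' z| ^ q) x = _
    rw [condAvg_singleton_eq, Fintype.card_fin]
    congr 1
    refine Finset.sum_congr rfl fun a _ => ?_
    show |noiseOn ρ {i} (fun x' => F x' z) (Function.update x i a)| ^ q = _
    rw [noiseOn_singleton]
    simp only
    rw [← hEa x z a]
    rfl
  -- (L) the fibre of `‖L_i F‖_q^q`
  have hL : lqM q (opX (lap {i}) F) = meanM (fun x z => (∑ a, |ψ x z a| ^ q) / m) := by
    unfold lqM
    rw [← meanM_opX_condAvg {i}]
    congr 1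
    funext x z
    show condAvg {i} (fun x' => |opX (lap {i}) F x' z| ^ q) x = _
    rw [condAvg_singleton_eq, Fintype.card_fin]
  -- (G) the fibre of `‖G_i F‖_q^q`
  have hG : lqM q (enc1 i F) = meanM (fun x z => mean (α := fun _ : Fin N × Fin m => Bool)
      (fun z' => |E x z + ∑ a, ((Real.sqrt m)⁻¹ * ψ x z a) * sgn (z' (i, a))| ^ q)) := by
    unfold lqM
    rw [← meanM_opB_condAvg (blk i)]
    congr 1
    funext x z
    show (∑ z', |enc1 i F x ((blk i).piecewise z' z)| ^ q) / cardX (fun _ : Fin N × Fin m => Bool) = _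
    unfold mean
    congr 1
    refine Finset.sum_congr rfl fun z' _ => ?_
    have hzz : ∀ p, p ∉ blk (m := m) i → (blk i).piecewise z' z p = z p := fun p hp =>
      Finset.piecewise_eq_of_notMem _ _ _ hp
    have h1 : E x ((blk i).piecewise z' z) = E x z := dependsOff_opX_cube hF (condAvg {i}) x _ _ hzz
    have h2 : ∀ a, opX (lap {i}) F (Function.update x i a) ((blk i).piecewise z' z) = ψ x z a :=
      fun a => dependsOff_opX_cube hF (lap {i}) (Function.update x i a) _ _ hzz
    have h3 : ∀ a, sgn ((blk i).piecewise z' z (i, a)) = sgn (z' (i, a)) := fun a => by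
      rw [Finset.piecewise_eq_of_mem _ _ _ (by simp)]
    rw [enc1_eq]
    show |E x ((blk i).piecewise z' z) + encLin i F x ((blk i).piecewise z' z)| ^ q = _
    rw [h1]
    unfold encLin
    rw [Finset.mul_sum]
    congr 3
    refine Finset.sum_congr rfl fun a _ => ?_
    rw [h3, ← h2 a]
    simp only [opX]
    ring
  rw [hT, hL, hG, ← meanM_smul, ← meanM_add]
  exact meanM_mono fun x z => fiber_ineq hq hρ0 hρ (E x z) (ψ x z) (hψ0 x z) i

end Fiber

/-! ## Proposition 3.1 and Theorem 4.1 -/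

section Main

variable {N m : ℕ}

/-- `(A ∪ {i}) ∖ (S ∪ {i}) = A ∖ S` for `i ∉ A`. [folklore] -/
private theorem insert_sdiff_insert_of_notMem {i : Fin N} {A S : Finset (Fin N)} (hi : i ∉ A) :
    insert i A \ insert i S = A \ S := by
  ext j
  simp only [Finset.mem_sdiff, Finset.mem_insert, not_or]
  constructor
  · rintro ⟨h1 | h1, h2, h3⟩
    · exact absurd h1 h2
    · exact ⟨h1, h3⟩
  · rintro ⟨h1, h2⟩
    exact ⟨Or.inr h1, fun h => hi (h ▸ h1), h2⟩

/-- **KLM Proposition 3.1** (Rademacher form, on the coordinates `A`): for `q > 2`, `0 < ρ ≤ 1/3` and `F` not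
reading the signs of the blocks `A`,
`‖T_{ρ,A} F‖_q^q ≤ ∑_{S ⊆ A} β^{q|S|} ‖L_S G_{A∖S} F‖_q^q`.
Induction on `A` by (3.3) and the commutation rules, as in the printed proof of (3.4).
[cite: KellerLifshitzMarcus2023, Prop. 3.1 (proof, eq. (3.4))] -/
theorem lqM_noiseOn_le_sum_encA [NeZero m] {q ρ : ℝ} (hq : 2 < q) (hρ0 : 0 < ρ) (hρ : ρ ≤ 1 / 3)
    (A : Finset (Fin N)) {F : MixFun N m}
    (hF : ∀ x, DependsOff (α := fun _ : Fin N × Fin m => Bool) (bits A) (F x)) :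
    lqM q (opX (noiseOn ρ A) F) ≤
      ∑ S ∈ A.powerset, klmBeta q ρ ^ (q * S.card) * lqM q (opX (lap S) (encA (A \ S) F)) := by
  have hβpos : 0 < klmBeta q ρ := lt_of_lt_of_le hρ0 (le_klmBeta hq.le hρ0 (by linarith))
  induction A using Finset.induction_on generalizing F with
  | empty =>
    rw [Finset.powerset_empty, Finset.sum_singleton, Finset.card_empty, Nat.cast_zero, mul_zero,
      Real.rpow_zero, one_mul, Finset.sdiff_self, encA_empty, opX_congr_of (fun g => noiseOn_empty ρ g),
      opX_congr_of (fun g => lap_empty g)]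
  | insert i A hi ih =>
    have hFi : ∀ x, DependsOff (α := fun _ : Fin N × Fin m => Bool) (blk i) (F x) := fun x =>
      (hF x).mono (by rw [bits_insert]; exact Finset.subset_union_left)
    have hFA : ∀ x, DependsOff (α := fun _ : Fin N × Fin m => Bool) (bits A) (F x) := fun x =>
      (hF x).mono (by rw [bits_insert]; exact Finset.subset_union_right)
    have hdisj : Disjoint ({i} : Finset (Fin N)) A := Finset.disjoint_singleton_left.2 hi
    have hsplit : opX (noiseOn ρ (insert i A)) F = opX (noiseOn ρ {i}) (opX (noiseOn ρ A) F) := by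
      rw [opX_opX]
      exact opX_congr_of (fun g => by
        show noiseOn ρ (insert i A) g = noiseOn ρ {i} (noiseOn ρ A g)
        rw [noiseOn_noiseOn_of_disjoint ρ hdisj, Finset.insert_eq]) F
    have hH : ∀ x, DependsOff (α := fun _ : Fin N × Fin m => Bool) (blk i) (opX (noiseOn ρ A) F x) :=
      dependsOff_opX_cube hFi _
    have step := lqM_noiseOn_single_le hq hρ0 hρ i hH
    have h1 : enc1 i (opX (noiseOn ρ A) F) = opX (noiseOn ρ A) (enc1 i F) := by
      rw [← encA_singleton, ← encA_singleton]
      exact encA_noiseOn_comm ρ hdisj.symm F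
    have h2 : opX (lap {i}) (opX (noiseOn ρ A) F) = opX (noiseOn ρ A) (opX (lap {i}) F) :=
      opX_comm_of (fun g => lap_noiseOn_comm ρ A {i} g) F
    have hF1 : ∀ x, DependsOff (α := fun _ : Fin N × Fin m => Bool) (bits A) (enc1 i F x) := by
      intro x
      rw [← encA_singleton]
      exact dependsOff_encA_cube (fun p hp => by
        rw [mem_bits] at hp
        rw [Finset.mem_singleton]
        exact fun h => hi (h ▸ hp)) hFA x
    have hF2 : ∀ x, DependsOff (α := fun _ : Fin N × Fin m => Bool) (bits A) (opX (lap {i}) F x) :=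
      dependsOff_opX_cube hFA _
    have ih1 := ih hF1
    have ih2 := ih hF2
    have hsum1 : ∑ S ∈ A.powerset, klmBeta q ρ ^ (q * S.card) * lqM q (opX (lap S) (encA (A \ S) (enc1 i F))) =
        ∑ S ∈ A.powerset, klmBeta q ρ ^ (q * S.card) * lqM q (opX (lap S) (encA (insert i A \ S) F)) := by
      refine Finset.sum_congr rfl fun S hS => ?_
      rw [Finset.mem_powerset] at hS
      have hiS : i ∉ S := fun h => hi (hS h)
      have hiAS : i ∉ A \ S := fun h => hi (Finset.sdiff_subset h)
      rw [Finset.insert_sdiff_of_notMem A hiS, encA_insert' hiAS]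
    have hsum2 : ∑ S ∈ A.powerset, klmBeta q ρ ^ (q * S.card) *
        lqM q (opX (lap S) (encA (A \ S) (opX (lap {i}) F))) =
        ∑ S ∈ A.powerset, klmBeta q ρ ^ (q * S.card) *
          lqM q (opX (lap (insert i S)) (encA (insert i A \ insert i S) F)) := by
      refine Finset.sum_congr rfl fun S hS => ?_
      rw [Finset.mem_powerset] at hS
      have hiAS : Disjoint ({i} : Finset (Fin N)) (A \ S) :=
        Finset.disjoint_singleton_left.2 fun h => hi (Finset.sdiff_subset h)
      have hl : (fun g : (Fin N → Fin m) → ℝ => lap S (lap {i} g)) = lap (insert i S) := by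
        funext g
        rw [lap_lap, Finset.union_comm, ← Finset.insert_eq]
      rw [encA_lap_comm hiAS, opX_opX, insert_sdiff_insert_of_notMem hi, hl]
    calc lqM q (opX (noiseOn ρ (insert i A)) F)
        = lqM q (opX (noiseOn ρ {i}) (opX (noiseOn ρ A) F)) := by rw [hsplit]
      _ ≤ lqM q (enc1 i (opX (noiseOn ρ A) F)) +
            klmBeta q ρ ^ q * lqM q (opX (lap {i}) (opX (noiseOn ρ A) F)) := step
      _ = lqM q (opX (noiseOn ρ A) (enc1 i F)) + klmBeta q ρ ^ q * lqM q (opX (noiseOn ρ A) (opX (lap {i}) F)) := by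
          rw [h1, h2]
      _ ≤ (∑ S ∈ A.powerset, klmBeta q ρ ^ (q * S.card) * lqM q (opX (lap S) (encA (A \ S) (enc1 i F)))) +
            klmBeta q ρ ^ q * ∑ S ∈ A.powerset, klmBeta q ρ ^ (q * S.card) *
              lqM q (opX (lap S) (encA (A \ S) (opX (lap {i}) F))) :=
          add_le_add ih1 (mul_le_mul_of_nonneg_left ih2 (Real.rpow_nonneg hβpos.le _))
      _ = ∑ S ∈ (insert i A).powerset, klmBeta q ρ ^ (q * S.card) * lqM q (opX (lap S) (encA (insert i A \ S) F)) := by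
          rw [hsum1, hsum2, Finset.sum_powerset_insert hi, Finset.mul_sum]
          congr 1
          refine Finset.sum_congr rfl fun S hS => ?_
          rw [Finset.mem_powerset] at hS
          have hiS : i ∉ S := fun h => hi (hS h)
          rw [Finset.card_insert_of_notMem hiS, Nat.cast_add, Nat.cast_one,
            show q * ((S.card : ℝ) + 1) = q * S.card + q by ring, Real.rpow_add hβpos]
          ring

/-- `bits S ∪ bits Sᶜ = everything`. [cite: KellerLifshitzMarcus2023, §3.1] -/
theorem bits_union_bits_compl (S : Finset (Fin N)) : bits (m := m) S ∪ bits Sᶜ = univ := by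
  ext p
  simp only [Finset.mem_union, mem_bits, Finset.mem_compl, Finset.mem_univ, iff_true]
  exact em _

/-- **The `S`-term of KLM Thm 4.1**: for `σ = 1/√q`,
`‖L_S G_{S^c} T_σ f‖_q^q ≤ q^{-q|S|/2} E_y ‖D_{S,y} f‖_2^q` — Fubini over `y`, `D_{S,y} T_σ = σ^{|S|} T_σ D_{S,y}`,
`G_{S^c} T^{Ω}_σ = T^{cube}_σ G_{S^c}`, `(2,q)`-hypercontractivity on the signs, `‖G_{S^c} D_{S,y} f‖₂ = ‖D_{S,y} f‖₂`.
[cite: KellerLifshitzMarcus2023, Thm. 4.1 (proof)] -/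
theorem lqM_lap_encA_noiseOn_le [NeZero m] {q : ℝ} (hq : 2 < q) (S : Finset (Fin N))
    (f : (Fin N → Fin m) → ℝ) :
    lqM q (opX (lap S) (encA Sᶜ (liftX (noiseOn (1 / Real.sqrt q) univ f)))) ≤
      q ^ (-(q * S.card) / 2) *
        mean (α := fun _ : Fin N => Fin m) (fun y => l2sq (deriv S y f) ^ (q / 2)) := by
  have hq0 : 0 < q := by linarith
  set σ : ℝ := 1 / Real.sqrt q with hσ
  have hσ0 : 0 < σ := by positivity
  have hσ2 : σ ^ 2 ≤ 1 / (q - 1) := by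
    rw [hσ, div_pow, one_pow, Real.sq_sqrt hq0.le]
    exact one_div_le_one_div_of_le (by linarith) (by linarith)
  have hσpow : |σ ^ S.card| ^ q = q ^ (-(q * S.card) / 2) := by
    have hσq : σ = q ^ (-(1 / 2 : ℝ)) := by
      rw [hσ, Real.rpow_neg hq0.le, ← Real.sqrt_eq_rpow, one_div]
    rw [abs_of_pos (pow_pos hσ0 _), ← Real.rpow_natCast, ← Real.rpow_mul hσ0.le, hσq,
      ← Real.rpow_mul hq0.le]
    congr 1; ring
  set Φ : MixFun N m := opX (lap S) (encA Sᶜ (liftX (noiseOn σ univ f))) with hΦ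
  -- (a) Fubini over the frozen coordinates
  have ha : lqM q Φ = mean (α := fun _ : Fin N => Fin m) (fun y => lqM q (opX (restr S y) Φ)) := by
    unfold lqM
    rw [← mean_meanM_restr S (fun x z => |Φ x z| ^ q)]
    rfl
  rw [ha, ← mean_smul]
  refine mean_mono fun y => ?_
  -- (b) `(L_S G T_σ f)_{S→y} = σ^{|S|} G_{S^c} T_{σ,S^c} D_{S,y} f`
  set g : (Fin N → Fin m) → ℝ := deriv S y f with hg
  have hgS : DependsOff (α := fun _ : Fin N => Fin m) S g := dependsOff_deriv S y f
  have hb : opX (restr S y) Φ = fun x z => σ ^ S.card * encA Sᶜ (liftX (noiseOn σ Sᶜ g)) x z := by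
    have h1 : opX (restr S y) Φ = opX (deriv S y) (encA Sᶜ (liftX (noiseOn σ univ f))) := by
      rw [hΦ, opX_opX]; rfl
    have h2 : opX (deriv S y) (encA Sᶜ (liftX (noiseOn σ univ f))) =
        encA Sᶜ (liftX (deriv S y (noiseOn σ univ f))) := by
      rw [← encA_deriv_comm (disjoint_compl_right : Disjoint S Sᶜ)]
      rfl
    have h3 : deriv S y (noiseOn σ univ f) = fun x => σ ^ S.card * noiseOn σ Sᶜ g x := by
      rw [deriv_noiseOn, Finset.inter_univ]
      funext x
      congr 1
      rw [← hg, ← Finset.union_compl S, Finset.union_comm,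
        ← noiseOn_noiseOn_of_disjoint σ disjoint_compl_left, noiseOn_of_dependsOff σ hgS]
    rw [h1, h2, h3]
    exact encA_smul Sᶜ (σ ^ S.card) (liftX (noiseOn σ Sᶜ g))
  rw [hb, lqM_smul, hσpow]
  refine mul_le_mul_of_nonneg_left ?_ (Real.rpow_nonneg hq0.le _)
  -- (c) intertwining and `x`-independence
  have hlift : ∀ x, DependsOff (α := fun _ : Fin N × Fin m => Bool) (bits Sᶜ) (liftX g x) :=
    dependsOff_liftX _ g
  have hKL : encA Sᶜ (liftX (noiseOn σ Sᶜ g)) =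
      fun x => noiseOn (α := fun _ : Fin N × Fin m => Bool) σ (bits Sᶜ) (encA Sᶜ (liftX g) x) := by
    rw [← opX_liftX, encA_noiseOn σ hlift]
  set φ : Cube N m → ℝ := encA Sᶜ (liftX g) (fun _ => 0) with hφ
  have hconst : encA Sᶜ (liftX g) = fun _ => φ := by
    funext x z
    exact encA_liftX_const (A := Sᶜ) (by rw [compl_compl]; exact hgS) x (fun _ => 0) z
  have hφS : DependsOff (α := fun _ : Fin N × Fin m => Bool) (bits S) φ :=
    dependsOff_encA_cube (fun p hp => by rw [mem_bits] at hp; rw [Finset.mem_compl]; exact fun h => h hp)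
      (dependsOff_liftX _ g) _
  have huniv : noiseOn (α := fun _ : Fin N × Fin m => Bool) σ (bits Sᶜ) φ =
      noiseOn (α := fun _ : Fin N × Fin m => Bool) σ univ φ := by
    rw [← bits_union_bits_compl S, ← noiseOn_noiseOn_of_disjoint σ (by
        rw [Finset.disjoint_left]; intro p hp hp'
        rw [mem_bits] at hp; rw [mem_bits, Finset.mem_compl] at hp'; exact hp' hp),
      noiseOn_of_dependsOff σ (dependsOff_noiseOn hφS σ _)]
  have hl : lqM q (encA Sᶜ (liftX (noiseOn σ Sᶜ g))) =
      lqPow (α := fun _ : Fin N × Fin m => Bool) q (noiseOn (α := fun _ : Fin N × Fin m => Bool) σ univ φ) := by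
    rw [hKL, hconst]
    unfold lqM meanM lqPow
    simp only
    rw [mean_const, huniv]
  -- (d) hypercontractivity on the signs and the isometry
  have hhc := lqPow_noiseOn_univ_le (κ := Fin N × Fin m) hq.le hσ0.le hσ2 φ
  have hiso : l2sq (α := fun _ : Fin N × Fin m => Bool) φ = l2sq g := by
    have h1 : l2sq (α := fun _ : Fin N × Fin m => Bool) φ = l2M (encA Sᶜ (liftX g)) := by
      rw [hconst]; unfold l2M meanM l2sq; simp only; rw [mean_const]
    rw [h1, l2M_encA hlift, l2M_liftX]
  rw [hl, ← hiso]
  exact hhc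

/-- **KLM Theorem 4.1 for `[m]^N`** (hypercontractivity for general functions, Rademacher-encoded proof):
for `m ≥ 1`, `q > 2`, `0 < ρ ≤ 1/3` and every `f : [m]^N → ℝ`,
`‖T_{ρ/√q} f‖_q^q ≤ ∑_S β^{q|S|} q^{-q|S|/2} E_y ‖D_{S,y} f‖_2^q`, i.e. `HcEstimate q ρ f`.
[cite: KellerLifshitzMarcus2023, Thm. 4.1] -/
theorem hcEstimate (N m : ℕ) (hm : 0 < m) (q ρ : ℝ) (f : (Fin N → Fin m) → ℝ) (hq : 2 < q)
    (hρ0 : 0 < ρ) (hρ : ρ ≤ 1 / 3) : HcEstimate (α := fun _ : Fin N => Fin m) q ρ f := by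
  haveI : NeZero m := ⟨hm.ne'⟩
  unfold HcEstimate
  have h0 : noiseOn (ρ / Real.sqrt q) univ f = noiseOn ρ univ (noiseOn (1 / Real.sqrt q) univ f) := by
    rw [noiseOn_noiseOn, mul_one_div]
  rw [h0, ← lqM_liftX, ← opX_liftX]
  have h1 := lqM_noiseOn_le_sum_encA hq hρ0 hρ (univ : Finset (Fin N))
    (F := liftX (noiseOn (1 / Real.sqrt q) univ f)) (fun x => dependsOff_liftX _ _ x)
  refine h1.trans ?_
  rw [Finset.powerset_univ]
  refine Finset.sum_le_sum fun S _ => ?_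
  rw [mul_assoc]
  refine mul_le_mul_of_nonneg_left ?_
    (Real.rpow_nonneg (klmBeta_nonneg hq.le hρ0.le (by linarith)) _)
  rw [← Finset.compl_eq_univ_sdiff]
  exact lqM_lap_encA_noiseOn_le hq S f

/-- **Discharge of the tree's named fact `KellerLifshitzMarcus2023_thm54`** (KLM Thm 5.4 on `[m]^N` in the
counting normalisation, constant `2200`): KLM §5 (`klm_thm54_of_hcEstimate`) fed with Thm 4.1 (`hcEstimate`).
[cite: KellerLifshitzMarcus2023, Thm. 5.4] -/
theorem KellerLifshitzMarcus2023_thm54_holds : KellerLifshitzMarcus2023_thm54 :=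
  klm_thm54_of_hcEstimate hcEstimate

end Main

end Literature.Combinatorics.Additive.ProductSpace
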